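import Summits.CriticalPhenomena.PercolationContinuityZ3.Theorems.PercNearOneGluingNoHeavyLowerTailAntitheticLobeFlip
import HarnessLib

/-!
# `NoHeavyLowerTail` (stmt-CriticalPhenomena-4575) — antithetic cluster pairs: THEOREM D⁺, part 1 (bleaching, family members, lobes)
# (prim-hp-2 gen 50, MEMO-gen50 §2 (L2⁺))

Support file (`--supports stmt-CriticalPhenomena-4575`, hull-port prover `prim-hp-2`, gen 50).  No named facts, no sorries; standard axioms.  The
`def`s (`Antithetic.Firm.*`) are proof-internal bookkeeping (clusters, flip sets, bleaching, blue lobes, the flip family), as in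
`…AntitheticLobes` for THEOREM D.

Setting (MEMO-gen31/49/50): colouring `ω ⊆ Sym2 V` of `E`, source `s`; `W = red`, `W' = blue` vertex clusters of `s`; core `W ∩ W'`; `D(R)`:
no vertex of `R` in the core; `Δ_{F,G}(ω) = (F(W) − F(W'))(G(W) − G(W'))` for increasing vertex functions `F, G`.  A colouring is FIRM if it lies
in `D(R)` and its core is joined to `s` in red AND in blue by paths INSIDE the core (a core `{s}` is firm: THEOREM D's slice).

**THEOREM D⁺** (`Antithetic.Firm.firm_slice_nonneg`, in the companion file `…AntitheticFirmSlice`): on every finite graph, for every source, forbidden set `R` and increasing `F, G`, the sum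
of `Δ_{F,G}` over the firm colourings is `≥ 0`.  Proof (MEMO-gen50 §2): BLEACH a firm `ω` (flip every edge meeting a red-only vertex,
`…AntitheticAbstractCubes`); the result `x` is nested with red cluster = core, blue cluster = `W ∪ W'`; the firm slice is partitioned into the
FLIP FAMILIES `{x ∆ fl S : S a union of blue lobes of x}` (`Firm.fam`; self-consistency `Firm.member_facts`: members have the same core, are firm,
and bleach back to `x`); each family is nonnegative by the two canonical abstract cubes (`Antithetic.firm_family_sum_nonneg` of
`…AntitheticFirmFamily`, `lobecube_sum_nonneg` of `…AntitheticLobeFlip`); the partition principle `sum_nonneg_of_parts` adds them up.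
[cite: VandenbergHaggstromKahn2005, §1 p. 6 ("Harris' inequality")]
-/

noncomputable section

namespace Summit.CriticalPhenomena.PercolationContinuityZ3.Theorems

open Literature.Probability.Percolation
open scoped Classical symmDiff

namespace Antithetic

/-! ## THEOREM D⁺ — assembly (firm slice) -/
namespace Firm

variable {V : Type*}

/-- red vertex cluster. [this work] -/
def red (E : Set (Sym2 V)) (s : V) (ω : Set (Sym2 V)) : Set V := openCluster (ω ∩ E) s
/-- blue vertex cluster. [this work] -/
def blue (E : Set (Sym2 V)) (s : V) (ω : Set (Sym2 V)) : Set V := openCluster (ωᶜ ∩ E) s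
/-- edges of `E` meeting the vertex set `S`. [this work] -/
def fl (E : Set (Sym2 V)) (S : Set V) : Set (Sym2 V) := {e | e ∈ E ∧ ∃ v ∈ e, v ∈ S}
/-- edges with both endpoints in `I`. [this work] -/
def inside (I : Set V) : Set (Sym2 V) := {e | ∀ w ∈ e, w ∈ I}
/-- the BLEACHED colouring: flip every edge meeting a red-only vertex. [this work] -/
def bleach (E : Set (Sym2 V)) (s : V) (ω : Set (Sym2 V)) : Set (Sym2 V) := ω ∆ fl E (red E s ω \ blue E s ω)
/-- blue-only vertices of a colouring. [this work] -/
def bo (E : Set (Sym2 V)) (s : V) (x : Set (Sym2 V)) : Set V := blue E s x \ red E s x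

section Lemmas

variable {E : Set (Sym2 V)} {s : V}

/-- `openGraph` is monotone in the edge set. [this work] -/
theorem openGraph_le {A B : Set (Sym2 V)} (h : A ⊆ B) : openGraph A ≤ openGraph B := by
  intro a b hab
  rw [openGraph_adj] at hab ⊢
  exact ⟨h hab.1, hab.2⟩

/-- an edge between a red-only and a blue-only vertex does not exist. [this work] -/
theorem no_edge_redonly_blueonly (ω : Set (Sym2 V)) {a b : V} (hE : s(a, b) ∈ E)
    (ha : a ∈ red E s ω) (ha' : a ∉ blue E s ω) (hb : b ∈ blue E s ω) (hb' : b ∉ red E s ω) : False := by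
  have hne : a ≠ b := by rintro rfl; exact hb' ha
  by_cases h : s(a, b) ∈ ω
  · exact hb' (ha.trans ((openGraph_adj (ω ∩ E) a b).2 ⟨⟨h, hE⟩, hne⟩).reachable)
  · have hE' : s(b, a) ∈ E := by rw [Sym2.eq_swap]; exact hE
    have h' : s(b, a) ∉ ω := by rw [Sym2.eq_swap]; exact h
    exact ha' (hb.trans ((openGraph_adj (ωᶜ ∩ E) b a).2 ⟨⟨h', hE'⟩, hne.symm⟩).reachable)

/-- edges inside the core are untouched by bleaching and by flipping closed blue-only sets:
`(ω ∆ fl E S) ∩ E ∩ inside I = ω ∩ E ∩ inside I` whenever `S ∩ I = ∅`. [this work] -/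
theorem flip_inter_inside (ω : Set (Sym2 V)) (S I : Set V) (hSI : Disjoint S I) :
    (ω ∆ fl E S) ∩ E ∩ inside I = ω ∩ E ∩ inside I := by
  ext e
  simp only [Set.mem_inter_iff]
  constructor
  · rintro ⟨⟨he, heE⟩, hin⟩
    refine ⟨⟨?_, heE⟩, hin⟩
    rw [Set.mem_symmDiff] at he
    rcases he with ⟨h, _⟩ | ⟨⟨_, v, hv, hvS⟩, _⟩
    · exact h
    · exact absurd (hin v hv) (Set.disjoint_left.1 hSI hvS)
  · rintro ⟨⟨he, heE⟩, hin⟩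
    refine ⟨⟨?_, heE⟩, hin⟩
    rw [Set.mem_symmDiff]
    exact Or.inl ⟨he, fun ⟨_, v, hv, hvS⟩ => Set.disjoint_left.1 hSI hvS (hin v hv)⟩

/-- complement version of `flip_inter_inside`: blue edges inside the core are untouched by flipping a set disjoint from it. [this work] -/
theorem compl_flip_inter_inside (ω : Set (Sym2 V)) (S I : Set V) (hSI : Disjoint S I) :
    (ω ∆ fl E S)ᶜ ∩ E ∩ inside I = ωᶜ ∩ E ∩ inside I := by
  have h : (ω ∆ fl E S)ᶜ = ωᶜ ∆ fl E S := by
    ext e; simp only [Set.mem_compl_iff, Set.mem_symmDiff]; tauto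
  rw [h]; exact flip_inter_inside ωᶜ S I hSI

/-- complement commutes with flipping: `(ω ∆ A)ᶜ = ωᶜ ∆ A`. [this work] -/
theorem compl_symmDiff_fl (ω A : Set (Sym2 V)) : (ω ∆ A)ᶜ = ωᶜ ∆ A := by
  ext e; simp only [Set.mem_compl_iff, Set.mem_symmDiff]; tauto

/-- **Bleaching shrinks the red cluster into the core** (`W(bleach ω) ⊆ W ∩ W'`): bleaching the red-only vertices of `ω` is flipping the
closed blue-only set `W ∖ W'` of the complementary colouring `ωᶜ`, so this is `lobeflip_blue_subset` (with `S = ∅`) read through the mirror.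
(Also in `…AntitheticAbstractCubes` as `bleach_red_subset`; re-derived here from the lobe-flip lemma.) [this work] -/
theorem red_bleach_subset_core (ω : Set (Sym2 V)) : red E s (bleach E s ω) ⊆ red E s ω ∩ blue E s ω := by
  have hdisj : Disjoint (red E s ω \ blue E s ω) (openCluster (ωᶜ ∩ E) s) :=
    Set.disjoint_left.2 fun v hv hv' => hv.2 hv'
  have hcl : ∀ a b, s(a, b) ∈ E → a ∈ red E s ω \ blue E s ω → b ∈ openCluster (ωᶜᶜ ∩ E) s →
      b ∉ openCluster (ωᶜ ∩ E) s → b ∈ red E s ω \ blue E s ω := by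
    intro a b _ _ hb hb'
    rw [compl_compl] at hb
    exact ⟨hb, hb'⟩
  have h := lobeflip_blue_subset E ωᶜ s ∅ (red E s ω \ blue E s ω) (Set.empty_subset _) hdisj hcl
  have h0 : (ωᶜ ∆ {e | e ∈ E ∧ ∃ v ∈ e, v ∈ (∅ : Set V)}) = ωᶜ := by
    have : {e : Sym2 V | e ∈ E ∧ ∃ v ∈ e, v ∈ (∅ : Set V)} = ∅ := by
      ext e; simp only [Set.mem_setOf_eq, Set.mem_empty_iff_false, and_false, exists_false]
    rw [this]; exact symmDiff_bot _
  rw [h0, compl_compl, ← compl_symmDiff_fl] at h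
  intro v hv
  have hv' := h (by simpa [red, bleach, fl] using hv)
  exact ⟨hv'.1, by_contra fun hn => hv'.2 ⟨hv'.1, hn⟩⟩

/-- **Bleaching makes everything reached blue** (`W ∪ W' ⊆ W'(bleach ω)`): `lobeflip_red_eq` for the complementary colouring `ωᶜ` and its
closed blue-only set `W ∖ W'`.  (Also in `…AntitheticAbstractCubes` as `bleach_blue_supset`.) [this work] -/
theorem union_subset_blue_bleach (ω : Set (Sym2 V)) : red E s ω ∪ blue E s ω ⊆ blue E s (bleach E s ω) := by
  have hSU : red E s ω \ blue E s ω ⊆ openCluster (ωᶜᶜ ∩ E) s := by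
    rw [compl_compl]; exact fun v hv => hv.1
  have hdisj : Disjoint (red E s ω \ blue E s ω) (openCluster (ωᶜ ∩ E) s) :=
    Set.disjoint_left.2 fun v hv hv' => hv.2 hv'
  have hcl : ∀ a b, s(a, b) ∈ E → a ∈ red E s ω \ blue E s ω → b ∈ openCluster (ωᶜᶜ ∩ E) s →
      b ∉ openCluster (ωᶜ ∩ E) s → b ∈ red E s ω \ blue E s ω := by
    intro a b _ _ hb hb'
    rw [compl_compl] at hb
    exact ⟨hb, hb'⟩
  have h := lobeflip_red_eq E ωᶜ s (red E s ω \ blue E s ω) hSU hdisj hcl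
  rw [← compl_symmDiff_fl] at h
  intro v hv
  have hv' : v ∈ openCluster (ωᶜ ∩ E) s ∪ (red E s ω \ blue E s ω) := by
    rcases hv with h1 | h2
    · by_cases hb : v ∈ blue E s ω
      · exact Or.inl hb
      · exact Or.inr ⟨h1, hb⟩
    · exact Or.inl h2
  rw [← h] at hv'
  simpa [blue, bleach, fl] using hv'

/-- **Bleaching a firm colouring**: red cluster = core, blue cluster = union. [this work] -/
theorem bleach_red_eq {ω : Set (Sym2 V)}
    (hωr : ∀ v, v ∈ red E s ω → v ∈ blue E s ω → (openGraph (ω ∩ E ∩ inside (red E s ω ∩ blue E s ω))).Reachable s v) :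
    red E s (bleach E s ω) = red E s ω ∩ blue E s ω := by
  apply Set.Subset.antisymm
  · exact red_bleach_subset_core ω
  · intro v hv
    have hr := hωr v hv.1 hv.2
    have hsub : ω ∩ E ∩ inside (red E s ω ∩ blue E s ω) ⊆ bleach E s ω ∩ E := by
      rw [bleach, ← flip_inter_inside ω (red E s ω \ blue E s ω) (red E s ω ∩ blue E s ω)
        (Set.disjoint_left.2 fun v hv hv' => hv.2 hv'.2)]
      exact Set.inter_subset_left
    exact hr.mono (openGraph_le hsub)

/-- the blue cluster of the bleached colouring is the union `red ∪ blue` of the original clusters. [this work] -/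
theorem bleach_blue_eq (ω : Set (Sym2 V)) :
    blue E s (bleach E s ω) = red E s ω ∪ blue E s ω := by
  apply Set.Subset.antisymm
  · -- the union is sealed against blue edges of the bleached colouring
    have hseal : ∀ a b, a ∉ (red E s ω ∪ blue E s ω)ᶜ → b ∈ (red E s ω ∪ blue E s ω)ᶜ →
        s(a, b) ∉ (bleach E s ω)ᶜ ∩ E := by
      intro a b ha hb hab
      have ha' : a ∈ red E s ω ∪ blue E s ω := not_not.1 ha
      have hbr : b ∉ red E s ω := fun h => hb (Or.inl h)
      have hbb : b ∉ blue E s ω := fun h => hb (Or.inr h)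
      have hne : a ≠ b := by rintro rfl; exact hb ha'
      obtain ⟨hx, hE⟩ := hab
      -- colour of s(a,b) in ω
      by_cases haro : a ∈ red E s ω ∧ a ∉ blue E s ω
      · -- a red-only: the edge meets the flip set, so bleach-blue means ω-red: then b ∈ red
        have hfl : s(a, b) ∈ fl E (red E s ω \ blue E s ω) := ⟨hE, a, Sym2.mem_mk_left a b, haro⟩
        have hω : s(a, b) ∈ ω := by
          by_contra h
          apply hx
          rw [bleach, Set.mem_symmDiff]; exact Or.inr ⟨hfl, h⟩
        exact hbr (haro.1.trans ((openGraph_adj (ω ∩ E) a b).2 ⟨⟨hω, hE⟩, hne⟩).reachable)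
      · -- a not red-only: edge unflipped; bleach-blue = ω-blue; a is blue (a ∈ red ∪ blue, not red-only) so b ∈ blue
        have hnfl : s(a, b) ∉ fl E (red E s ω \ blue E s ω) := by
          rintro ⟨_, v, hv, hvro⟩
          rcases Sym2.mem_iff.1 hv with rfl | rfl
          · exact haro ⟨hvro.1, hvro.2⟩
          · exact hbr hvro.1
        have hω : s(a, b) ∉ ω := by
          intro h; apply hx
          rw [bleach, Set.mem_symmDiff]; exact Or.inl ⟨h, hnfl⟩
        have hab : a ∈ blue E s ω := by
          rcases ha' with h | h
          · by_contra h'; exact haro ⟨h, h'⟩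
          · exact h
        exact hbb (hab.trans ((openGraph_adj (ωᶜ ∩ E) a b).2 ⟨⟨hω, hE⟩, hne⟩).reachable)
    intro v hv
    have hs : s ∉ (red E s ω ∪ blue E s ω)ᶜ := fun h => h (Or.inl (mem_openCluster_self _ _))
    exact not_not.1 (reachable_of_sealed _ _ s _ hs (fun _ _ _ _ => Iff.rfl) hseal hv).2
  · exact union_subset_blue_bleach ω

/-- the original colouring is a member of the family of its bleaching: the red-only set is closed. [this work] -/
theorem redonly_closed {ω : Set (Sym2 V)}
    (hωr : ∀ v, v ∈ red E s ω → v ∈ blue E s ω → (openGraph (ω ∩ E ∩ inside (red E s ω ∩ blue E s ω))).Reachable s v) :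
    (red E s ω \ blue E s ω) ⊆ bo E s (bleach E s ω) ∧
      ∀ a b, s(a, b) ∈ E → a ∈ (red E s ω \ blue E s ω) → b ∈ bo E s (bleach E s ω) → b ∈ (red E s ω \ blue E s ω) := by
  refine ⟨fun v hv => ?_, fun a b hE ha hb => ?_⟩
  · rw [bo, bleach_red_eq hωr, bleach_blue_eq]
    exact ⟨Or.inl hv.1, fun h => hv.2 h.2⟩
  · rw [bo, bleach_red_eq hωr, bleach_blue_eq] at hb
    -- b ∈ (red ∪ blue) \ core; if b were blue-only the edge a-b would join red-only to blue-only
    obtain ⟨hbU, hbI⟩ := hb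
    by_cases hbr : b ∈ red E s ω
    · exact ⟨hbr, fun h => hbI ⟨hbr, h⟩⟩
    · have hbb : b ∈ blue E s ω := hbU.resolve_left hbr
      exact (no_edge_redonly_blueonly ω hE ha.1 ha.2 hbb hbr).elim

/-- `ω` is recovered from its bleaching by flipping back the edges at its red-only vertices. [this work] -/
theorem mem_family_self (ω : Set (Sym2 V)) :
    ω = bleach E s ω ∆ fl E (red E s ω \ blue E s ω) := by
  rw [bleach, symmDiff_assoc, symmDiff_self, symmDiff_bot]

end Lemmas

section Members

variable {E : Set (Sym2 V)} {s : V}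

/-- **Family members of a firm colouring.**  `ω` firm (core internally red- and blue-connected), `x = bleach ω`, `J` = core of `ω`,
`U = red ω ∪ blue ω`; `S` a closed set of blue-only vertices of `x`; `M = x ∆ fl S`.  Then: red `M = J ∪ S`, `J ⊆` blue `M ⊆ U ∖ S`,
the core of `M` is `J`, `M` is firm with the same core, and `bleach M = x`. [this work] -/
theorem member_facts {ω : Set (Sym2 V)}
    (hωr : ∀ v, v ∈ red E s ω → v ∈ blue E s ω → (openGraph (ω ∩ E ∩ inside (red E s ω ∩ blue E s ω))).Reachable s v)
    (hωb : ∀ v, v ∈ red E s ω → v ∈ blue E s ω → (openGraph (ωᶜ ∩ E ∩ inside (red E s ω ∩ blue E s ω))).Reachable s v)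
    {S : Set V} (hS : S ⊆ bo E s (bleach E s ω))
    (hcl : ∀ a b, s(a, b) ∈ E → a ∈ S → b ∈ bo E s (bleach E s ω) → b ∈ S) :
    let J := red E s ω ∩ blue E s ω
    let M := bleach E s ω ∆ fl E S
    red E s M = J ∪ S ∧ J ⊆ blue E s M ∧ blue E s M ⊆ (red E s ω ∪ blue E s ω) \ S ∧
      red E s M ∩ blue E s M = J ∧
      M ∩ E ∩ inside J = ω ∩ E ∩ inside J ∧ Mᶜ ∩ E ∩ inside J = ωᶜ ∩ E ∩ inside J ∧
      red E s M \ blue E s M = S ∧ bleach E s M = bleach E s ω := by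
  intro J M
  set x := bleach E s ω with hx
  have hJx : red E s x = J := bleach_red_eq hωr
  have hUx : blue E s x = red E s ω ∪ blue E s ω := bleach_blue_eq ω
  have hSU : S ⊆ openCluster (xᶜ ∩ E) s := fun v hv => (hS hv).1
  have hSJ : Disjoint S (openCluster (x ∩ E) s) := Set.disjoint_left.2 fun v hv hvJ => (hS hv).2 hvJ
  have hcl' : ∀ a b, s(a, b) ∈ E → a ∈ S → b ∈ openCluster (xᶜ ∩ E) s → b ∉ openCluster (x ∩ E) s → b ∈ S :=
    fun a b hE ha hbU hbJ => hcl a b hE ha ⟨hbU, hbJ⟩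
  -- (1) red M
  have h1 : red E s M = J ∪ S := by
    have := lobeflip_red_eq E x s S hSU hSJ hcl'
    rw [← hJx]; exact this
  -- (3) blue M ⊆ U \ S
  have h3 : blue E s M ⊆ (red E s ω ∪ blue E s ω) \ S := by
    have h := lobeflip_blue_subset E x s ∅ S (Set.empty_subset _) hSJ hcl'
    have h0 : {e : Sym2 V | e ∈ E ∧ ∃ v ∈ e, v ∈ (∅ : Set V)} = ∅ := by ext e; simp
    have hx0 : x ∆ (∅ : Set (Sym2 V)) = x := by
      rw [Set.symmDiff_def, Set.sdiff_empty, Set.empty_sdiff, Set.union_empty]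
    rw [h0, hx0] at h
    rw [← hUx]; exact h
  -- edges inside J are untouched
  have hROJ : Disjoint (red E s ω \ blue E s ω) J := Set.disjoint_left.2 fun v hv hvJ => hv.2 hvJ.2
  have hSJ' : Disjoint S J := Set.disjoint_left.2 fun v hv hvJ => by
    have := (hS hv).2; rw [hJx] at this; exact this hvJ
  have h5 : M ∩ E ∩ inside J = ω ∩ E ∩ inside J := by
    show (bleach E s ω ∆ fl E S) ∩ E ∩ inside J = ω ∩ E ∩ inside J
    rw [flip_inter_inside _ S J hSJ', bleach, flip_inter_inside _ _ J hROJ]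
  have h6 : Mᶜ ∩ E ∩ inside J = ωᶜ ∩ E ∩ inside J := by
    show (bleach E s ω ∆ fl E S)ᶜ ∩ E ∩ inside J = ωᶜ ∩ E ∩ inside J
    rw [compl_flip_inter_inside _ S J hSJ', bleach, compl_flip_inter_inside _ _ J hROJ]
  -- (2) J ⊆ blue M  (internal blue paths survive)
  have h2 : J ⊆ blue E s M := by
    intro v hv
    have hr := hωb v hv.1 hv.2
    have hsub : ωᶜ ∩ E ∩ inside J ⊆ Mᶜ ∩ E := by rw [← h6]; exact Set.inter_subset_left
    exact hr.mono (openGraph_le hsub)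
  -- (4) core M = J
  have h4 : red E s M ∩ blue E s M = J := by
    apply Set.Subset.antisymm
    · rintro v ⟨hvr, hvb⟩
      rw [h1] at hvr
      rcases hvr with hvJ | hvS
      · exact hvJ
      · exact absurd hvS (h3 hvb).2
    · exact fun v hv => ⟨by rw [h1]; exact Or.inl hv, h2 hv⟩
  -- (7) red-only set of M is S
  have h7 : red E s M \ blue E s M = S := by
    apply Set.Subset.antisymm
    · rintro v ⟨hvr, hvb⟩
      rw [h1] at hvr
      rcases hvr with hvJ | hvS
      · exact absurd (h2 hvJ) hvb
      · exact hvS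
    · intro v hvS
      exact ⟨by rw [h1]; exact Or.inr hvS, fun hvb => (h3 hvb).2 hvS⟩
  -- (8) bleach M = x
  have h8 : bleach E s M = x := by
    rw [bleach, h7]
    show (bleach E s ω ∆ fl E S) ∆ fl E S = x
    rw [symmDiff_assoc, symmDiff_self, symmDiff_bot]
  exact ⟨h1, h2, h3, h4, h5, h6, h7, h8⟩

end Members

end Firm

end Antithetic

end Summit.CriticalPhenomena.PercolationContinuityZ3.Theorems
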